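import Summits.BirchSwinnertonDyer.BirchSwinnertonDyer.Theses.PAdicOrderV2
import Summits.BirchSwinnertonDyer.BirchSwinnertonDyer.Theorems.PAdicOrderV2PAdicOrderComparisonR2StubOrderEqSelmerCorank
import Summits.BirchSwinnertonDyer.BirchSwinnertonDyer.Theorems.PAdicOrderV2PAdicOrderComparisonR2StubKerMulTRatSqEq
import Literature.NumberTheory.EllipticCurves.PAdicBSD
import Literature.NumberTheory.EllipticCurves.SelmerCorankControl
import Literature.NumberTheory.EllipticCurves.KatoRankBoundProofs
import Literature.NumberTheory.EllipticCurves.IwasawaSelmerDualProofs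

/-!
# Crux `PAdicOrderPadicBSDrankR2` (stmt-BirchSwinnertonDyer-0490), line `Sketch` — stub MC-SS-CT:
# `ord_{T=0} L_p(E,T) = corank_{ℤ_p} Sel_{p^∞}(E/ℚ)` at every ODD good ordinary prime

Registered stub `stub_padicBSDrank_orderEqCorankOdd` of the skeleton
`Cruxes/PAdicOrderPadicBSDrankR2/Lines/Sketch.lean` (v3). Pure glue from three route inputs taken
BY NAME as antecedents:
* Mazur's cyclotomic main conjecture `PAdicOrderMainConjectureR7` (stmt-15426: at every good ordinary
  `p ≥ 3`, for the cyclotomic `κ` with topological generator `γ` matching the variable `T`, the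
  newform `f` of `E` and any dual datum `D`, `X = D.X` is `Λ`-torsion and `char_Λ X = (g)` with
  `ι g = p^k · L_p(f, α_p, T)`),
* Greenberg's Conj. 1.12 at `T` in its integral spelling `PAdicOrderSemisimpleR3` (stmt-0509:
  `p^k T² x = 0 ⇒ p^{k'} T x = 0` on `X`), and
* Mazur's control theorem in corank form `Greenberg1999_coinvariantsRank_eq_selmerCorank_rat`
  (`rank_{ℤ_p} X/TX = corank_{ℤ_p} Sel_{p^∞}(E/ℚ)`).
Proof: pick the cyclotomic `κ, γ` matching the variable
(`exists_isCyclotomic_isTopGenerator_isCyclotomicVariable_holds`) and a dual datum `D`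
(`WeierstrassCurve.nonempty_selmerDualData_holds`); the landed SS-bridge `stub_ker_mulTRat_sq_eq`
turns stmt-0509 into `ker (T ⊗ 1)² = ker (T ⊗ 1)` on `ℚ_p ⊗_{ℤ_p} X`, and the landed bookkeeping
`stub_order_eq_selmerCorank` (MC ∧ SS ∧ CT ⇒ `ord_T L_p = corank`) concludes.
Greenberg, LNM 1716, §1, Conj. 1.12 and the paragraph after it (p. 65).
-/

-- D-0017: single-problem summit, so `Summit.BirchSwinnertonDyer.BirchSwinnertonDyer.…` repeats a
-- namespace BY DESIGN.
set_option linter.dupNamespace false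

namespace Summit.BirchSwinnertonDyer.BirchSwinnertonDyer.Theorems

open scoped MatrixGroups ModularForm TensorProduct
open CongruenceSubgroup Literature.NumberTheory.EllipticCurves
  Literature.NumberTheory.EllipticCurves.ModularForms
  Literature.NumberTheory.EllipticCurves.IwasawaAlgebra
open Summit.BirchSwinnertonDyer.BirchSwinnertonDyer.Theses.PAdicOrderV2

/-- **Stub MC-SS-CT of line `Sketch` (crux #3 `PAdicOrderPadicBSDrankR2`):
`ord_{T=0} L_p(E,T) = corank_{ℤ_p} Sel_{p^∞}(E/ℚ)` at every ODD good ordinary point, from three route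
inputs by name** — Mazur's main conjecture `PAdicOrderMainConjectureR7` (stmt-15426: `X` torsion,
`char_Λ X = (g)`, `ι g = p^k L_p(E,T)`), Greenberg's Conj. 1.12 at `T` in its integral spelling
`PAdicOrderSemisimpleR3` (stmt-0509), and Mazur control
`Greenberg1999_coinvariantsRank_eq_selmerCorank_rat`. Proof: take the cyclotomic `κ, γ` matching the
variable (`exists_isCyclotomic_isTopGenerator_isCyclotomicVariable_holds`) and a dual datum `D`
(`nonempty_selmerDualData_holds`); the landed SS-bridge `stub_ker_mulTRat_sq_eq` turns 0509 into
`ker T² = ker T` on `ℚ_p ⊗ X`, and the landed bookkeeping `stub_order_eq_selmerCorank` concludes.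
[cite: GreenbergLNM1716, §1 Conj. 1.12 and p. 65] -/
theorem stub_padicBSDrank_orderEqCorankOdd :
    PAdicOrderMainConjectureR7 → PAdicOrderSemisimpleR3 →
    Greenberg1999_coinvariantsRank_eq_selmerCorank_rat →
    ∀ (W : WeierstrassCurve ℚ) [W.IsElliptic] [W.IsGloballyMinimal] (p : ℕ) [Fact p.Prime],
      p ≠ 2 → IsOrdinaryAt W p → ∀ {N : ℕ} [NeZero N] (f : CuspForm (Gamma0 N) 2), IsNewformOf W f →
      (padicLFunction f (unitRoot W p : ℚ_[p])).order = W.selmerCorank p := by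
  intro hMC hSS hCT W _ _ p _ hp2 hord N _ f hf
  have hp3 : 3 ≤ p := by
    have := (Fact.out : p.Prime).two_le
    omega
  -- the cyclotomic datum matching the variable `T`, and a Pontryagin-dual datum `D`
  obtain ⟨κ, hκ, γ, hγ, hγ'⟩ := exists_isCyclotomic_isTopGenerator_isCyclotomicVariable_holds p
  obtain ⟨D⟩ := W.nonempty_selmerDualData_holds κ γ hγ
  -- (MC): the route item stmt-15426 — `X` torsion, `char X = (g)`, `ι g = p^k · L_p`
  obtain ⟨htors, hmc⟩ := hMC W p hp3 hord.1 hord.2 κ γ hκ hγ hγ' f hf D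
  -- (SS): the route item stmt-0509 through the landed SS-bridge
  have hss := stub_ker_mulTRat_sq_eq p D.X (hSS W p hp2 hord.1 hord.2 κ γ hκ hγ D)
  -- (CT): Mazur control, rank clause
  have hctrl := (hCT W p hord.1 hord.2 κ γ hκ hγ D).2
  exact stub_order_eq_selmerCorank W p κ γ hκ hγ f D htors hmc hss hctrl

end Summit.BirchSwinnertonDyer.BirchSwinnertonDyer.Theorems
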